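import Summits.RiemannHypothesis.RiemannHypothesis.Theorems.SoloInformedGroundStateLimit

/-!
# Ground-state endgame, II: (M2) as weighted L² tracking; Temple–Kato

Solo programme `solo-RiemannHypothesis-informed`, session 1 — part of the assembled endgame of
the semilocal (Weil ground state) programme (Connes 2026, arXiv:2602.04022, §6.6); overview in
`SoloInformedGroundStateLimit.lean`. Everything here is proved; the only named fact used anywhere
in the package is `Connes2026_weilGroundState_zeros_re_eq_half` (C–vS Thm. 6.1), as a hypothesis.

`riemannHypothesis_of_L2_tracking`: (M2) split into Connes's Fact 6.4 for explicit comparison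
vectors and weighted `L²` tracking `e^{α aₙ} √(2aₙ) ‖cₙ uₙ − kₙ‖₂ → 0` (`0 < α < 1/2`), via the
Cauchy–Schwarz strip bound `norm_weilMellin_le_of_ae_vanish`; and the Temple–Kato inequality
`groundState_dist_sq_le` governing tracking by excess energy over gap.
-/

noncomputable section

open Complex Filter Set Topology Metric MeasureTheory
open Literature.NumberTheory.LFunctions

namespace Summit.RiemannHypothesis.RiemannHypothesis.Theorems

/-! ## Splitting (M2): Fact 6.4 for the comparison vectors + weighted `L²` tracking

Connes (2026, §6.5, Fact 6.4) states that the transforms of his EXPLICIT prolate vectors `k_λ`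
converge to `Ξ` uniformly on closed substrips of `|Im z| < 1/2` (error `c λ^{-1/2-α}/(1 - 2α)` on
`Im z = α`), and (§6.6) that "it still remains to show that `k_λ` is a sufficiently good
approximation of `θ`". The theorems below make "sufficiently good" precise and typed: because the
Mellin transform on the line `Im z = α` is controlled by the window `L²` norm with the weight
`e^{α a}` (Cauchy–Schwarz on `[-a, a]`, `norm_weilMellin_le_of_ae_vanish`), it suffices that
`e^{α aₙ} √(2aₙ) ‖cₙ uₙ − kₙ‖₂ → 0` for every `0 < α < 1/2` (`riemannHypothesis_of_L2_tracking`).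
With `aₙ = log λₙ` the weight is `λₙ^α`: tracking in `L²` at rate `o(λ^{-1/2} (log λ)^{-1/2})`
is enough, tracking at rate `o(1)` is not (by this route). -/

section Tracking

/-- The strip `|Im z| < 1/2` is open. -/
theorem isOpen_xiStrip : IsOpen xiStrip :=
  isOpen_lt (continuous_abs.comp Complex.continuous_im) continuous_const

/-- On a compact subset of the open strip, `|Im z|` is bounded by some `α ∈ (0, 1/2)`. -/
theorem exists_abs_im_le_of_isCompact {K : Set ℂ} (hK : IsCompact K) (hKs : K ⊆ xiStrip) :
    ∃ α : ℝ, 0 < α ∧ α < 1 / 2 ∧ ∀ z ∈ K, |z.im| ≤ α := by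
  rcases K.eq_empty_or_nonempty with rfl | hne
  · exact ⟨1 / 4, by norm_num, by norm_num, fun z hz ↦ hz.elim⟩
  · obtain ⟨z₀, hz₀, hmax⟩ :=
      hK.exists_isMaxOn hne (continuous_abs.comp Complex.continuous_im).continuousOn
    have h0 : |z₀.im| < 1 / 2 := hKs hz₀
    refine ⟨max |z₀.im| (1 / 4), lt_max_iff.2 (Or.inr (by norm_num)), max_lt h0 (by norm_num),
      fun z hz ↦ ?_⟩
    exact le_trans (isMaxOn_iff.1 hmax z hz) (le_max_left _ _)

/-- **The Mellin transform on the strip is controlled by the window `L²` norm.** If `f ∈ L²`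
vanishes a.e. off `[-a, a]` (`0 ≤ a`), then for every `z`,
`|f̂(1/2 + i z)| ≤ e^{|Im z| a} · √(2a) · ‖f‖₂`: indeed `f̂(1/2 + iz) = ∫_{-a}^{a} f(t) e^{izt} dt`,
`|e^{izt}| = e^{-(Im z) t} ≤ e^{|Im z| a}` on the window, and Cauchy–Schwarz on `[-a, a]`. -/
theorem norm_weilMellin_le_of_ae_vanish {f : ℝ → ℂ} {a : ℝ} (ha : 0 ≤ a) (hf : MemLp f 2)
    (hfa : ∀ᵐ t : ℝ, t ∉ Icc (-a) a → f t = 0) (z : ℂ) :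
    ‖weilMellin f (1 / 2 + I * z)‖ ≤
      Real.exp (|z.im| * a) * (Real.sqrt (2 * a) * Real.sqrt (∫ t, ‖f t‖ ^ 2)) := by
  -- the comparison function `𝟙_{[-a,a]}` and its `L²` data
  set g : ℝ → ℂ := (Icc (-a) a).indicator fun _ ↦ (1 : ℂ) with hg
  have hgm : MemLp g 2 volume :=
    memLp_indicator_const 2 measurableSet_Icc (1 : ℂ) (Or.inr measure_Icc_lt_top.ne)
  have hg_norm : ∀ t, ‖g t‖ = (Icc (-a) a).indicator (fun _ ↦ (1 : ℝ)) t := fun t ↦ by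
    rw [hg, norm_indicator_eq_indicator_norm]
    simp
  -- `f` is integrable (it is `L²` on a window of finite measure and vanishes off it)
  have hIcc : IntegrableOn f (Icc (-a) a) := (hf.restrict (Icc (-a) a)).integrable one_le_two
  have hfi : Integrable f := hIcc.integrable_of_ae_notMem_eq_zero hfa
  -- Cauchy–Schwarz: `∫ |f| · 𝟙 ≤ ‖f‖₂ · √(2a)`
  have hCS : ∫ t, ‖f t‖ * ‖g t‖ ≤ Real.sqrt (∫ t, ‖f t‖ ^ 2) * Real.sqrt (2 * a) := by
    have hf' : MemLp f (ENNReal.ofReal 2) volume := by simpa using hf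
    have hg' : MemLp g (ENNReal.ofReal 2) volume := by simpa using hgm
    have key := integral_mul_norm_le_Lp_mul_Lq Real.HolderConjugate.two_two hf' hg'
    have h1 : ∫ t, ‖f t‖ ^ (2 : ℝ) = ∫ t, ‖f t‖ ^ 2 := by simp_rw [Real.rpow_two]
    have h2 : ∫ t, ‖g t‖ ^ (2 : ℝ) = 2 * a := by
      simp_rw [Real.rpow_two, hg_norm]
      have h3 : (fun t ↦ ((Icc (-a) a).indicator (fun _ ↦ (1 : ℝ)) t) ^ 2) =
          (Icc (-a) a).indicator fun _ ↦ (1 : ℝ) := by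
        funext t
        by_cases ht : t ∈ Icc (-a) a <;> simp [ht]
      rw [h3, integral_indicator_const _ measurableSet_Icc, Real.volume_real_Icc_of_le (by linarith),
        smul_eq_mul, mul_one]
      ring
    rw [h1, h2, ← Real.sqrt_eq_rpow, ← Real.sqrt_eq_rpow] at key
    exact key
  -- pointwise bound on the window: `|f(t) e^{izt}| ≤ e^{|Im z| a} |f(t)|` a.e.
  have hpt : ∀ᵐ t : ℝ, ‖f t * cexp ((1 / 2 + I * z - 1 / 2) * t)‖ ≤
      Real.exp (|z.im| * a) * ‖f t‖ := by
    filter_upwards [hfa] with t ht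
    by_cases htI : t ∈ Icc (-a) a
    · rw [norm_mul, Complex.norm_exp, mul_comm]
      gcongr
      have h1 : (1 / 2 + I * z - 1 / 2) * (t : ℂ) = I * (z * t) := by ring
      rw [h1, Complex.I_mul_re]
      have htabs : |t| ≤ a := abs_le.2 ⟨by linarith [htI.1], htI.2⟩
      have him : (z * (t : ℂ)).im = z.im * t := by simp [mul_im]
      rw [him]
      calc -(z.im * t) ≤ |z.im * t| := neg_le_abs _
        _ = |z.im| * |t| := abs_mul _ _
        _ ≤ |z.im| * a := by gcongr
    · rw [ht htI]
      simp
  -- `∫ |f| = ∫ |f| 𝟙` since `f` vanishes a.e. off the window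
  have hfg : ∫ t, ‖f t‖ = ∫ t, ‖f t‖ * ‖g t‖ := by
    refine integral_congr_ae ?_
    filter_upwards [hfa] with t ht
    by_cases htI : t ∈ Icc (-a) a
    · simp [hg_norm, htI]
    · simp [ht htI]
  calc ‖weilMellin f (1 / 2 + I * z)‖
      = ‖∫ t : ℝ, f t * cexp ((1 / 2 + I * z - 1 / 2) * t)‖ := rfl
    _ ≤ ∫ t, Real.exp (|z.im| * a) * ‖f t‖ := norm_integral_le_of_norm_le (hfi.norm.const_mul _) hpt
    _ = Real.exp (|z.im| * a) * ∫ t, ‖f t‖ * ‖g t‖ := by rw [integral_const_mul, hfg]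
    _ ≤ Real.exp (|z.im| * a) * (Real.sqrt (∫ t, ‖f t‖ ^ 2) * Real.sqrt (2 * a)) := by gcongr
    _ = Real.exp (|z.im| * a) * (Real.sqrt (2 * a) * Real.sqrt (∫ t, ‖f t‖ ^ 2)) := by ring

/-- **RH from (M1), Fact 6.4 for the comparison vectors, and weighted `L²` tracking.** Let `uₙ` be
ground states on windows `[-aₙ, aₙ]` whose bottoms are simple and even (M1), `cₙ ≠ 0` constants,
and `kₙ ∈ L²` comparison vectors vanishing a.e. off the same windows (Connes's `k_λ`, or anything
else) whose transforms `z ↦ k̂ₙ(1/2 + iz)` converge to `Ξ` locally uniformly on the strip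
(Connes 2026, Fact 6.4, for `k_λ`). If the ground states TRACK the comparison vectors in the
weighted `L²` sense `e^{α aₙ} √(2aₙ) ‖cₙ uₙ − kₙ‖₂ → 0` for every `0 < α < 1/2`, then the
Riemann hypothesis holds. (The weight `e^{α aₙ} = λₙ^{α}` for `aₙ = log λₙ` is the price of
passing from `L²` of the window to the line `Im z = α`.) -/
theorem riemannHypothesis_of_L2_tracking
    (hfact : Connes2026_weilGroundState_zeros_re_eq_half)
    (a : ℕ → ℝ) (u k : ℕ → ℝ → ℂ) (c : ℕ → ℂ)
    (hM1 : ∀ n, WeilWindowSimpleEven (a n)) (hu : ∀ n, IsWeilGroundState (a n) (u n))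
    (hc : ∀ n, c n ≠ 0) (hk : ∀ n, MemLp (k n) 2)
    (hka : ∀ n, ∀ᵐ t : ℝ, t ∉ Icc (-(a n)) (a n) → k n t = 0)
    (hkXi : TendstoLocallyUniformlyOn (fun n z ↦ weilMellin (k n) (1 / 2 + I * z))
      riemannXiUpper atTop xiStrip)
    (htrack : ∀ α : ℝ, 0 < α → α < 1 / 2 →
      Tendsto (fun n ↦ Real.exp (α * a n) *
        (Real.sqrt (2 * a n) * Real.sqrt (∫ t, ‖c n * u n t - k n t‖ ^ 2))) atTop (𝓝 0)) :
    _root_.RiemannHypothesis := by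
  refine riemannHypothesis_of_weilGroundStates hfact (l := atTop) a u c
    (Eventually.of_forall hM1) (Eventually.of_forall hu) (Eventually.of_forall hc) ?_
  rw [tendstoLocallyUniformlyOn_iff_forall_isCompact isOpen_xiStrip]
  intro K hKs hK
  obtain ⟨α, hα0, hα, hKα⟩ := exists_abs_im_le_of_isCompact hK hKs
  have hkK : TendstoUniformlyOn (fun n z ↦ weilMellin (k n) (1 / 2 + I * z)) riemannXiUpper
      atTop K :=
    (tendstoLocallyUniformlyOn_iff_forall_isCompact isOpen_xiStrip).1 hkXi K hKs hK
  rw [Metric.tendstoUniformlyOn_iff] at hkK ⊢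
  intro ε hε
  have hε2 : 0 < ε / 2 := by positivity
  filter_upwards [hkK (ε / 2) hε2, (htrack α hα0 hα).eventually (gt_mem_nhds hε2)]
    with n hn htr z hz
  set s : ℂ := 1 / 2 + I * z with hs
  -- the difference of transforms is the transform of the difference
  have hIu : Integrable fun t : ℝ ↦ c n * (u n t * cexp ((s - 1 / 2) * t)) :=
    ((hu n).integrable_mul_cexp (s - 1 / 2)).const_mul (c n)
  have hkI : IntegrableOn (k n) (Icc (-(a n)) (a n)) :=
    ((hk n).restrict (Icc (-(a n)) (a n))).integrable one_le_two
  have hIk : Integrable fun t : ℝ ↦ k n t * cexp ((s - 1 / 2) * t) :=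
    (hkI.mul_continuousOn (by fun_prop) isCompact_Icc).integrable_of_ae_notMem_eq_zero
      ((hka n).mono fun t ht hts ↦ by simp [ht hts])
  have hdiff : c n * weilMellin (u n) s - weilMellin (k n) s =
      weilMellin (fun t ↦ c n * u n t - k n t) s := by
    simp only [weilMellin, ← integral_const_mul]
    rw [← integral_sub hIu hIk]
    refine integral_congr_ae (Eventually.of_forall fun t ↦ ?_)
    simp only
    ring
  -- `L²` data of the difference
  have hf2 : MemLp (fun t ↦ c n * u n t - k n t) 2 := ((hu n).memLp.const_mul (c n)).sub (hk n)
  have hfa : ∀ᵐ t : ℝ, t ∉ Icc (-(a n)) (a n) → c n * u n t - k n t = 0 := by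
    filter_upwards [(hu n).ae_eq_zero_of_notMem, hka n] with t h1 h2 hts
    simp [h1 hts, h2 hts]
  have hB : ‖c n * weilMellin (u n) s - weilMellin (k n) s‖ ≤
      Real.exp (α * a n) * (Real.sqrt (2 * a n) *
        Real.sqrt (∫ t, ‖c n * u n t - k n t‖ ^ 2)) := by
    rw [hdiff, hs]
    refine (norm_weilMellin_le_of_ae_vanish (hu n).pos.le hf2 hfa z).trans ?_
    exact mul_le_mul_of_nonneg_right
      (Real.exp_le_exp.2 (mul_le_mul_of_nonneg_right (hKα z hz) (hu n).pos.le)) (by positivity)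
  calc dist (riemannXiUpper z) (c n * weilMellin (u n) s)
      ≤ dist (riemannXiUpper z) (weilMellin (k n) s) +
          dist (weilMellin (k n) s) (c n * weilMellin (u n) s) := dist_triangle _ _ _
    _ < ε / 2 + ε / 2 := by
        refine add_lt_add (hn z hz) ?_
        rw [dist_eq_norm, norm_sub_rev]
        exact hB.trans_lt htr
    _ = ε := add_halves ε

end Tracking

/-! ## Why tracking reduces to two RELATIVE spectral quantities (Temple–Kato for the ground state)

In a real inner product space let `q` be a quadratic form (with polar form `B`) bounded below by
`ε₀ ‖·‖²`, attaining `ε₀` at a unit vector `θ`, and `≥ ε₁ ‖·‖²` on `θ^⊥` with `ε₁ > ε₀` (simple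
isolated bottom, i.e. (M1) with a gap). Then for EVERY vector `k`,
`(ε₁ − ε₀) ‖k − ⟪θ, k⟫ θ‖² ≤ q k − ε₀ ‖k‖²` (`groundState_dist_sq_le`): the distance from `k` to the
ground-state line is controlled by the EXCESS ENERGY of `k` relative to the GAP. Instantiated (on
paper: the closed Weil form on `L²` of the window, `θ = θ_λ`, `k = k_λ`), the tracking hypothesis
of `riemannHypothesis_of_L2_tracking` follows from
`(Q(k_λ) − ε₀(λ)‖k_λ‖²) / (ε₁(λ) − ε₀(λ)) = o(λ^{-1} (log λ)^{-1}) ‖k_λ‖²`, a statement about two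
RELATIVE quantities — the excess energy of Connes's prolate vector over the bottom, and the
spectral gap above the bottom — both of the doubly-exponentially small size `~ e^{-4π λ²}`
(Connes 2026, §6.4). Neither quantity presupposes the SIGN of `ε₀(λ)` (i.e. Weil positivity). -/

section Temple

open scoped InnerProductSpace

variable {E : Type*} [NormedAddCommGroup E] [InnerProductSpace ℝ E]

/-- **Temple–Kato inequality for a simple ground state.** `q` a quadratic form with polar form
`B` (`q (x + t • y) = q x + 2 t B x y + t² q y`), `ε₀ ‖x‖² ≤ q x` for all `x` with equality at
the unit vector `θ`, and `ε₁ ‖y‖² ≤ q y` on `θ^⊥`. Then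
`(ε₁ − ε₀) ‖k − ⟪θ, k⟫ θ‖² ≤ q k − ε₀ ‖k‖²` for every `k`. (First variation at the minimiser
kills the cross term `B θ y`; then `q k − ε₀‖k‖² = q y − ε₀‖y‖² ≥ (ε₁ − ε₀)‖y‖²` for the
component `y` of `k` orthogonal to `θ`.) -/
theorem groundState_dist_sq_le (q : E → ℝ) (B : E → E → ℝ)
    (hq : ∀ (x y : E) (t : ℝ), q (x + t • y) = q x + 2 * t * B x y + t ^ 2 * q y)
    {ε₀ ε₁ : ℝ} {θ : E} (hθ : ‖θ‖ = 1) (hθq : q θ = ε₀)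
    (hmin : ∀ x, ε₀ * ‖x‖ ^ 2 ≤ q x) (hgap : ∀ y, ⟪θ, y⟫_ℝ = 0 → ε₁ * ‖y‖ ^ 2 ≤ q y) (k : E) :
    (ε₁ - ε₀) * ‖k - ⟪θ, k⟫_ℝ • θ‖ ^ 2 ≤ q k - ε₀ * ‖k‖ ^ 2 := by
  set c : ℝ := ⟪θ, k⟫_ℝ with hc
  set y : E := k - c • θ with hy
  have hθθ : ⟪θ, θ⟫_ℝ = 1 := by rw [real_inner_self_eq_norm_sq, hθ, one_pow]
  have hθy : ⟪θ, y⟫_ℝ = 0 := by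
    rw [hy, inner_sub_right, real_inner_smul_right, hθθ, mul_one, ← hc, sub_self]
  have hk : y + c • θ = k := sub_add_cancel k (c • θ)
  -- symmetry of the polar form
  have hsymm : ∀ x y : E, B x y = B y x := fun x y ↦ by
    have h1 := hq x y 1
    have h2 := hq y x 1
    simp only [one_smul, one_pow, one_mul, mul_one] at h1 h2
    rw [add_comm y x] at h2
    linarith
  -- first variation at the minimiser: `B θ y = 0`
  have hvar : ∀ t : ℝ, 0 ≤ 2 * t * B θ y + t ^ 2 * (q y - ε₀ * ‖y‖ ^ 2) := fun t ↦ by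
    have h1 := hmin (θ + t • y)
    have h2 : ‖θ + t • y‖ ^ 2 = 1 + t ^ 2 * ‖y‖ ^ 2 := by
      rw [norm_add_sq_real, real_inner_smul_right, hθy, norm_smul, mul_pow, Real.norm_eq_abs,
        sq_abs, hθ]
      ring
    rw [hq, hθq, h2] at h1
    nlinarith [h1]
  have hD : 0 ≤ q y - ε₀ * ‖y‖ ^ 2 := by nlinarith [hmin y]
  have hb : B θ y = 0 := by
    set b : ℝ := B θ y
    set D : ℝ := q y - ε₀ * ‖y‖ ^ 2
    have hD1 : 0 < D + 1 := by linarith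
    set σ : ℝ := (D + 1)⁻¹ with hσ
    have hσ0 : 0 < σ := inv_pos.2 hD1
    have hσ1 : σ * (D + 1) = 1 := inv_mul_cancel₀ hD1.ne'
    have key : 0 ≤ -(σ * b ^ 2) - σ ^ 2 * b ^ 2 := by
      have h := hvar (-(σ * b))
      have e : 2 * (-(σ * b)) * b + (-(σ * b)) ^ 2 * D =
          -(σ * b ^ 2) - σ ^ 2 * b ^ 2 + σ * b ^ 2 * (σ * (D + 1) - 1) := by ring
      rw [e, hσ1, sub_self, mul_zero, add_zero] at h
      exact h
    have h1 : 0 ≤ σ * b ^ 2 := mul_nonneg hσ0.le (sq_nonneg b)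
    have h2 : 0 ≤ σ ^ 2 * b ^ 2 := mul_nonneg (sq_nonneg σ) (sq_nonneg b)
    have h3 : σ * b ^ 2 = 0 := by linarith
    rcases mul_eq_zero.1 h3 with h | h
    · exact absurd h hσ0.ne'
    · exact pow_eq_zero_iff two_ne_zero |>.1 h
  -- energy and norm of `k = y + c θ`
  have hqk : q k = q y + c ^ 2 * ε₀ := by
    have h := hq y θ c
    rw [hk, hsymm y θ, hb, hθq] at h
    linarith
  have hnk : ‖k‖ ^ 2 = ‖y‖ ^ 2 + c ^ 2 := by
    have h := norm_add_sq_real y (c • θ)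
    rw [hk, real_inner_smul_right, real_inner_comm, hθy, norm_smul, mul_pow, Real.norm_eq_abs,
      sq_abs, hθ] at h
    linarith
  have hgy := hgap y hθy
  rw [hqk, hnk]
  nlinarith [hgy]

/-- The same inequality in the "sin² ≤ excess / gap" form for the normalised data: with
`ε₀ < ε₁`, `‖k − ⟪θ, k⟫ θ‖² ≤ (q k − ε₀ ‖k‖²) / (ε₁ − ε₀)`. -/
theorem groundState_dist_sq_le_div (q : E → ℝ) (B : E → E → ℝ)
    (hq : ∀ (x y : E) (t : ℝ), q (x + t • y) = q x + 2 * t * B x y + t ^ 2 * q y)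
    {ε₀ ε₁ : ℝ} (h01 : ε₀ < ε₁) {θ : E} (hθ : ‖θ‖ = 1) (hθq : q θ = ε₀)
    (hmin : ∀ x, ε₀ * ‖x‖ ^ 2 ≤ q x) (hgap : ∀ y, ⟪θ, y⟫_ℝ = 0 → ε₁ * ‖y‖ ^ 2 ≤ q y) (k : E) :
    ‖k - ⟪θ, k⟫_ℝ • θ‖ ^ 2 ≤ (q k - ε₀ * ‖k‖ ^ 2) / (ε₁ - ε₀) := by
  rw [le_div_iff₀ (sub_pos.2 h01), mul_comm]
  exact groundState_dist_sq_le q B hq hθ hθq hmin hgap k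

end Temple

end Summit.RiemannHypothesis.RiemannHypothesis.Theorems
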